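import Summits.Ventures.PercRepro.ProfileMixedStep

/-!
# PercRepro — COLLISION pairs are always paid (p10, gen 0; S5, Proposition 2‴ (iii))

In the single-element induction for families with comparable members of equal rank (H⁺'s families), two members
`B ∌ e` and `B ∪ {e}` of the same rank (so `e ∈ cl B`) map to the same set `B` of `M ／ {e}`; the one contraction
price of `B` must pay both.  It does:

* `pi_insert_eq_pi_delete` — `pi M u (insert e B) = pi (M ＼ {e}) u B` (same rank, same complement);
* `pi_le_pi_contract_of_mem_closure` — `pi M u B ≤ pi (M ／ {e}) (u − 1) B` when `e ∈ cl B` (`cpr_le_B2`);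
* **`pi_add_pi_insert_le`** — `pi M u B + pi M u (insert e B) ≤ pi (M ＼ {e}) u B + pi (M ／ {e}) (u − 1) B`.
-/

open scoped Matroid

namespace PercRepro.Skew

open Finset ThmH Shadow Profile

variable {α : Type} [DecidableEq α] {M : Matroid α} [M.Finite] {e : α} {u : ℕ}

/-- For `e ∉ B` with `e ∈ cl B`, the price of `B ∪ {e}` in `M` is the price of `B` in `M ＼ {e}`. -/
theorem pi_insert_eq_pi_delete (he : M.Indep {e}) {B : Finset α} (hB : B ⊆ gr M) (heB : e ∉ B)
    (hcl : e ∈ clF M B) : pi M u (insert e B) = pi (M ＼ ({e} : Set α)) u B := by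
  have heE : e ∈ gr M := mem_gr_of_indep he
  have hB' : B ⊆ (gr M).erase e := Finset.subset_erase.2 ⟨hB, heB⟩
  have hr : rk M (insert e B) = rk M B := by rw [rk_insert_eq heE hB, if_pos hcl]
  have hc : gr M \ insert e B = (gr M \ B).erase e := by
    ext x
    simp only [Finset.mem_sdiff, Finset.mem_insert, Finset.mem_erase, not_or]
    tauto
  unfold pi
  rw [hr, hc, rk_delete hB', gr_delete', erase_sdiff,
    rk_delete (Finset.erase_subset_erase e Finset.sdiff_subset)]

/-- For a non-loop `e ∉ B` with `e ∈ cl B`, the price of `B` in `M` is at most its price in `M ／ {e}` at level `u − 1`. -/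
theorem pi_le_pi_contract_of_mem_closure (he : M.Indep {e}) (hu : 1 ≤ u) {B : Finset α} (hB : B ⊆ gr M)
    (heB : e ∉ B) (hcl : e ∈ clF M B) : pi M u B ≤ pi (M ／ ({e} : Set α)) (u - 1) B := by
  have heE : e ∈ gr M := mem_gr_of_indep he
  have hB' : B ⊆ (gr M).erase e := Finset.subset_erase.2 ⟨hB, heB⟩
  have heC : e ∈ gr M \ B := Finset.mem_sdiff.2 ⟨heE, heB⟩
  have hC' : (gr M \ B).erase e ⊆ (gr M).erase e := Finset.erase_subset_erase e Finset.sdiff_subset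
  set b := rk M B with hb
  set p' := rk M (gr M \ B) with hp'
  have hcB : rk (M ／ ({e} : Set α)) B + 1 = b := by
    rw [rk_contract_add_one he hB', rk_insert_eq heE hB, if_pos hcl]
  have hcC : rk (M ／ ({e} : Set α)) ((gr M \ B).erase e) + 1 = p' := by
    rw [rk_contract_add_one he hC', Finset.insert_erase heC]
  have hb1 : 1 ≤ b := by omega
  have hcB' : rk (M ／ ({e} : Set α)) B = b - 1 := by omega
  have hcC' : rk (M ／ ({e} : Set α)) ((gr M \ B).erase e) = p' - 1 := by omega
  unfold pi
  rw [gr_contract', erase_sdiff, ← hb, ← hp', hcB', hcC']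
  rcases lt_trichotomy b u with hlt | heq | hgt
  · rcases le_or_gt u p' with hup | hup
    · exact cpr_le_B2 hb1 hlt.le hup
    · rw [cpr_of_lt_of_gt hlt hup]; exact cpr_nonneg _ _ _
  · subst heq; rw [cpr_self, cpr_self]
  · rw [cpr_of_gt hgt]; exact cpr_nonneg _ _ _

/-- **Collision pairs are paid**: for a non-loop `e ∉ B` with `e ∈ cl B`, the prices of `B` and `B ∪ {e}` in `M` are
together at most the price of `B` in `M ＼ {e}` plus the price of `B` in `M ／ {e}` at level `u − 1`. -/
theorem pi_add_pi_insert_le (he : M.Indep {e}) (hu : 1 ≤ u) {B : Finset α} (hB : B ⊆ gr M) (heB : e ∉ B)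
    (hcl : e ∈ clF M B) :
    pi M u B + pi M u (insert e B) ≤ pi (M ＼ ({e} : Set α)) u B + pi (M ／ ({e} : Set α)) (u - 1) B := by
  have h1 := pi_insert_eq_pi_delete (u := u) he hB heB hcl
  have h2 := pi_le_pi_contract_of_mem_closure he hu hB heB hcl
  rw [h1]
  linarith

end PercRepro.Skew
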